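import Summits.PneNP.PneNP.Theorems.ChebyshevTracialDesignSliceLadders
import HarnessLib

/-!
# Cell pnp-psdrank, route `ChebyshevTracialDesign`: keys and closed sets of a fixed-point-free involution
# (the vertex encoding of a perfect matching), and an alternating binomial identity

Harmonic backbone, brick 4a (MEMO-7 §1 (1a)/(1e), combinatorial half). A perfect matching of `Fin n` is encoded by
its partner map, a fixed-point-free involution `π`; a vertex set is `π`-CLOSED (`M`-saturated) iff it contains the
partner of each of its points; a KEY is a vertex `x < π x` (one per matching edge, `two_mul_card_keys`: `2·#keys = n`).
Closed sets correspond to sets of keys (`closed_eq_union_image`, `union_image_props`, `card_closed_eq_two_mul`), and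
the closed sets of size `2a` containing a given `T` are counted by the `a`-sets of keys containing the key-shadow
`E(T) = (T ∪ πT) ∩ keys` (`card_closed_supersets_eq`, `card_closed_supersets_eq_choose`:
`= C(n/2 − |E(T)|, a − |E(T)|)` or `0`), with `2|E(T)| = 2|T| − d_π(T)` (`two_mul_card_keyShadow`,
`d_π(T) = #{x ∈ T : π x ∈ T}`). Also the inclusion–exclusion identity `Σ_j (−1)^j C(κ,j) C(A−j, B−j) = C(A−κ, B)`
(`alternating_choose_sum`). These are the counting inputs of the `B`-scalar of the saturation factorisation of
Rothvoß's level kernels [cite: Rothvoss2017, §2 (PDF p. 6)] [cite: GodsilMeagher2015, §15.2 (perfect matching scheme)].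
WHAT THIS IS NOT: pure counting; nothing on harmonics or psd rank here. Supports crux stmt-PneNP-19878.
-/

set_option linter.dupNamespace false -- `Summit.PneNP.PneNP.…`: summit = sub-problem (D-0017)

noncomputable section

namespace Summit.PneNP.PneNP.Theorems.ChebyshevTracialDesignInvolutionKeys

open Finset
open Summit.PneNP.PneNP.Theorems.ChebyshevTracialDesignSliceLadders

variable {n : ℕ}

/-! ### §1 The alternating binomial identity -/

/-- `Σ_{j ≤ κ} (−1)^j C(κ,j) C(A−j, B−j) = C(A−κ, B)` for `κ ≤ A` (inclusion–exclusion for the `B`-subsets of an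
`A`-set avoiding a fixed `κ`-subset; the summand is `0` once `j > B`). -/
theorem alternating_choose_sum (κ : ℕ) : ∀ A B : ℕ, κ ≤ A →
    ∑ j ∈ range (κ + 1), (-1 : ℝ) ^ j * (κ.choose j : ℝ) *
        (if j ≤ B then (((A - j).choose (B - j) : ℕ) : ℝ) else 0) = (((A - κ).choose B : ℕ) : ℝ) := by
  induction κ with
  | zero => intro A B _; simp
  | succ κ ih =>
    intro A B hA
    -- Pascal on `C(κ+1, j)` : split the sum
    have hsplit : ∀ j ∈ range (κ + 1 + 1), (-1 : ℝ) ^ j * ((κ + 1).choose j : ℝ) *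
        (if j ≤ B then (((A - j).choose (B - j) : ℕ) : ℝ) else 0) =
        (-1 : ℝ) ^ j * (κ.choose j : ℝ) * (if j ≤ B then (((A - j).choose (B - j) : ℕ) : ℝ) else 0) +
        (-1 : ℝ) ^ j * ((if j = 0 then 0 else κ.choose (j - 1) : ℕ) : ℝ) *
          (if j ≤ B then (((A - j).choose (B - j) : ℕ) : ℝ) else 0) := by
      intro j _
      rcases j with _ | j
      · simp
      · rw [Nat.choose_succ_succ', if_neg (Nat.succ_ne_zero j), Nat.add_sub_cancel]
        push_cast; ring
    rw [sum_congr rfl hsplit, sum_add_distrib]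
    -- first part: the `κ` identity (the extra term `j = κ+1` vanishes)
    have h1 : ∑ j ∈ range (κ + 1 + 1), (-1 : ℝ) ^ j * (κ.choose j : ℝ) *
        (if j ≤ B then (((A - j).choose (B - j) : ℕ) : ℝ) else 0) = (((A - κ).choose B : ℕ) : ℝ) := by
      rw [sum_range_succ, ih A B (by omega), Nat.choose_succ_self]; simp
    -- second part: shift `j = j' + 1`
    have h2 : ∑ j ∈ range (κ + 1 + 1), (-1 : ℝ) ^ j * ((if j = 0 then 0 else κ.choose (j - 1) : ℕ) : ℝ) *
        (if j ≤ B then (((A - j).choose (B - j) : ℕ) : ℝ) else 0) =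
        -∑ j ∈ range (κ + 1), (-1 : ℝ) ^ j * (κ.choose j : ℝ) *
          (if j + 1 ≤ B then (((A - (j + 1)).choose (B - (j + 1)) : ℕ) : ℝ) else 0) := by
      rw [sum_range_succ', if_pos rfl]
      simp only [Nat.cast_zero, mul_zero, zero_mul, add_zero, Nat.add_sub_cancel, if_neg (Nat.succ_ne_zero _),
        pow_succ, neg_mul, mul_neg, mul_one, sum_neg_distrib]
    rw [h1, h2]
    rcases B with _ | B
    · -- `B = 0`: the shifted sum is empty of content
      simp
    · have hshift : ∑ j ∈ range (κ + 1), (-1 : ℝ) ^ j * (κ.choose j : ℝ) *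
          (if j + 1 ≤ B + 1 then (((A - (j + 1)).choose (B + 1 - (j + 1)) : ℕ) : ℝ) else 0) =
          ∑ j ∈ range (κ + 1), (-1 : ℝ) ^ j * (κ.choose j : ℝ) *
            (if j ≤ B then ((((A - 1) - j).choose (B - j) : ℕ) : ℝ) else 0) := by
        refine sum_congr rfl fun j _ => ?_
        have e1 : A - (j + 1) = A - 1 - j := by omega
        have e2 : B + 1 - (j + 1) = B - j := by omega
        by_cases hj : j ≤ B
        · rw [if_pos (by omega), if_pos hj, e1, e2]
        · rw [if_neg (by omega), if_neg hj]
      rw [hshift, ih (A - 1) B (by omega)]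
      have e3 : A - 1 - κ = A - (κ + 1) := by omega
      rw [e3]
      have hP := Nat.choose_succ_succ' (A - (κ + 1)) B
      have e4 : A - (κ + 1) + 1 = A - κ := by omega
      rw [e4] at hP
      rw [hP]; push_cast; ring

/-! ### §2 Keys and closed sets of a fixed-point-free involution -/

section Keys

variable {π : Fin n → Fin n} (hinv : ∀ x, π (π x) = x) (hfix : ∀ x, π x ≠ x)
include hinv hfix

/-- Exactly one of `x`, `π x` is a key (`y` is a key iff `y < π y`). -/
theorem key_or_key (x : Fin n) : (x < π x ∧ ¬ π x < π (π x)) ∨ (¬ x < π x ∧ π x < π (π x)) := by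
  rw [hinv]
  rcases lt_or_gt_of_ne (hfix x) with h | h
  · exact Or.inr ⟨not_lt.2 h.le, h⟩
  · exact Or.inl ⟨h, not_lt.2 h.le⟩

/-- A closed set is recovered from its keys: `V = (V ∩ keys) ∪ π(V ∩ keys)`. -/
theorem closed_eq_union_image {V : Finset (Fin n)} (hV : ∀ x ∈ V, π x ∈ V) :
    V = V.filter (fun x => x < π x) ∪ (V.filter (fun x => x < π x)).image π := by
  ext x
  simp only [mem_union, mem_filter, mem_image]
  constructor
  · intro hx
    rcases key_or_key hinv hfix x with ⟨h1, -⟩ | ⟨-, h2⟩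
    · exact Or.inl ⟨hx, h1⟩
    · exact Or.inr ⟨π x, ⟨hV x hx, h2⟩, hinv x⟩
  · rintro (⟨hx, -⟩ | ⟨y, ⟨hy, -⟩, rfl⟩)
    · exact hx
    · exact hV y hy

omit hfix in
/-- Keys and their partners are disjoint. -/
theorem disjoint_keys_image {K : Finset (Fin n)} (hK : ∀ x ∈ K, x < π x) : Disjoint K (K.image π) := by
  refine disjoint_left.2 fun x hxK hxI => ?_
  obtain ⟨y, hy, rfl⟩ := mem_image.1 hxI
  have h1 := hK y hy
  have h2 := hK (π y) hxK
  rw [hinv] at h2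
  exact lt_asymm h1 h2

/-- A closed set has twice as many points as keys. -/
theorem card_closed_eq_two_mul {V : Finset (Fin n)} (hV : ∀ x ∈ V, π x ∈ V) :
    V.card = 2 * (V.filter (fun x => x < π x)).card := by
  conv_lhs => rw [closed_eq_union_image hinv hfix hV]
  rw [card_union_of_disjoint (disjoint_keys_image hinv fun x hx => (mem_filter.1 hx).2),
    card_image_of_injective _ (Function.LeftInverse.injective hinv)]
  ring

/-- `n` is even: twice the number of keys. -/
theorem two_mul_card_keys : 2 * ((univ : Finset (Fin n)).filter (fun x => x < π x)).card = n := by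
  have := card_closed_eq_two_mul hinv hfix (V := (univ : Finset (Fin n))) (fun x _ => mem_univ _)
  rw [card_univ, Fintype.card_fin] at this
  exact this.symm

omit hfix in
/-- The union of a set of keys with its partners is closed, has the given keys, and twice the size. -/
theorem union_image_props {K : Finset (Fin n)} (hK : ∀ x ∈ K, x < π x) :
    (∀ x ∈ K ∪ K.image π, π x ∈ K ∪ K.image π) ∧ (K ∪ K.image π).filter (fun x => x < π x) = K ∧
      (K ∪ K.image π).card = 2 * K.card := by
  refine ⟨?_, ?_, ?_⟩
  · intro x hx
    rcases mem_union.1 hx with h | h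
    · exact mem_union.2 (Or.inr (mem_image_of_mem π h))
    · obtain ⟨y, hy, rfl⟩ := mem_image.1 h
      rw [hinv]; exact mem_union.2 (Or.inl hy)
  · ext x
    simp only [mem_filter, mem_union, mem_image]
    constructor
    · rintro ⟨h | ⟨y, hy, rfl⟩, hx⟩
      · exact h
      · exfalso
        have := hK y hy
        rw [hinv] at hx
        exact lt_asymm this hx
    · intro hx; exact ⟨Or.inl hx, hK x hx⟩
  · rw [card_union_of_disjoint (disjoint_keys_image hinv hK),
      card_image_of_injective _ (Function.LeftInverse.injective hinv)]
    ring

/-- For a closed `V`: `T ⊆ V` iff the key-shadow `E(T) = (T ∪ πT) ∩ keys` lies in the keys of `V`. -/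
theorem subset_closed_iff {V : Finset (Fin n)} (hV : ∀ x ∈ V, π x ∈ V) (T : Finset (Fin n)) :
    T ⊆ V ↔ (T ∪ T.image π).filter (fun x => x < π x) ⊆ V.filter (fun x => x < π x) := by
  constructor
  · intro hTV x hx
    rw [mem_filter] at hx ⊢
    refine ⟨?_, hx.2⟩
    rcases mem_union.1 hx.1 with h | h
    · exact hTV h
    · obtain ⟨y, hy, rfl⟩ := mem_image.1 h
      exact hV y (hTV hy)
  · intro hE x hxT
    rcases key_or_key hinv hfix x with ⟨h1, -⟩ | ⟨-, h2⟩
    · exact (mem_filter.1 (hE (mem_filter.2 ⟨mem_union.2 (Or.inl hxT), h1⟩))).1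
    · have : π x ∈ V := (mem_filter.1 (hE (mem_filter.2 ⟨mem_union.2 (Or.inr (mem_image_of_mem π hxT)), h2⟩))).1
      have := hV _ this
      rwa [hinv] at this

/-- **Counting closed supersets by keys.** The closed sets of size `2a` containing `T` are in bijection (`V ↦ V ∩ keys`)
with the `a`-sets of keys containing the key-shadow `E(T)`. -/
theorem card_closed_supersets_eq (T : Finset (Fin n)) (a : ℕ) :
    ((powersetCard (2 * a) (univ : Finset (Fin n))).filter
        (fun V => (∀ x ∈ V, π x ∈ V) ∧ T ⊆ V)).card =
      ((powersetCard a ((univ : Finset (Fin n)).filter (fun x => x < π x))).filter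
        (fun K => (T ∪ T.image π).filter (fun x => x < π x) ⊆ K)).card := by
  refine card_nbij' (fun V => V.filter (fun x => x < π x)) (fun K => K ∪ K.image π) ?_ ?_ ?_ ?_
  · intro V hV
    simp only [mem_coe, mem_filter, mem_powersetCard, subset_univ, true_and] at hV ⊢
    obtain ⟨hcard, hcl, hTV⟩ := hV
    refine ⟨⟨fun x hx => mem_filter.2 ⟨mem_univ _, (mem_filter.1 hx).2⟩, ?_⟩,
      (subset_closed_iff hinv hfix hcl T).1 hTV⟩
    have := card_closed_eq_two_mul hinv hfix hcl
    omega
  · intro K hK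
    simp only [mem_coe, mem_filter, mem_powersetCard, subset_univ, true_and] at hK ⊢
    obtain ⟨⟨hKkeys, hKcard⟩, hEK⟩ := hK
    have hK' : ∀ x ∈ K, x < π x := fun x hx => (mem_filter.1 (hKkeys hx)).2
    obtain ⟨hcl, hkeys, hcard⟩ := union_image_props hinv hK'
    refine ⟨by rw [hcard, hKcard], hcl, ?_⟩
    rw [subset_closed_iff hinv hfix hcl T, hkeys]
    exact hEK
  · intro V hV
    simp only [mem_coe, mem_filter, mem_powersetCard] at hV
    exact (closed_eq_union_image hinv hfix hV.2.1).symm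
  · intro K hK
    simp only [mem_coe, mem_filter, mem_powersetCard] at hK
    exact (union_image_props hinv fun x hx => (mem_filter.1 (hK.1.1 hx)).2).2.1

/-- The count in closed form: `#{V closed, |V| = 2a, T ⊆ V} = C(N − |E(T)|, a − |E(T)|)` if `|E(T)| ≤ a`, else `0`
(`N` = number of keys = `n/2`). -/
theorem card_closed_supersets_eq_choose (T : Finset (Fin n)) (a : ℕ) :
    (((powersetCard (2 * a) (univ : Finset (Fin n))).filter
        (fun V => (∀ x ∈ V, π x ∈ V) ∧ T ⊆ V)).card : ℝ) =
      if ((T ∪ T.image π).filter (fun x => x < π x)).card ≤ a then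
        (((((univ : Finset (Fin n)).filter (fun x => x < π x)).card -
            ((T ∪ T.image π).filter (fun x => x < π x)).card).choose
          (a - ((T ∪ T.image π).filter (fun x => x < π x)).card) : ℕ) : ℝ)
      else 0 := by
  rw [card_closed_supersets_eq hinv hfix T a]
  have hsub : (T ∪ T.image π).filter (fun x => x < π x) ⊆ (univ : Finset (Fin n)).filter (fun x => x < π x) :=
    fun x hx => mem_filter.2 ⟨mem_univ _, (mem_filter.1 hx).2⟩
  split_ifs with h
  · rw [card_filter_powersetCard_superset hsub h]
  · rw [Nat.cast_eq_zero, card_eq_zero, filter_eq_empty_iff]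
    intro K hK hEK
    rw [mem_powersetCard] at hK
    exact h (hK.2 ▸ card_le_card hEK)

/-- **Size of the key-shadow.** `2·|E(T)| = 2|T| − d_π(T)` where `d_π(T) = #{x ∈ T : π x ∈ T}`. -/
theorem two_mul_card_keyShadow (T : Finset (Fin n)) :
    2 * ((T ∪ T.image π).filter (fun x => x < π x)).card + (T.filter (fun x => π x ∈ T)).card = 2 * T.card := by
  -- the closure `T ∪ πT` is closed, so it has `2|E(T)|` points; and `|T ∪ πT| = 2|T| − |T ∩ πT|`, `T ∩ πT = {x ∈ T : π x ∈ T}`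
  have hcl : ∀ x ∈ T ∪ T.image π, π x ∈ T ∪ T.image π := by
    intro x hx
    rcases mem_union.1 hx with h | h
    · exact mem_union.2 (Or.inr (mem_image_of_mem π h))
    · obtain ⟨y, hy, rfl⟩ := mem_image.1 h
      rw [hinv]; exact mem_union.2 (Or.inl hy)
  have h1 := card_closed_eq_two_mul hinv hfix hcl
  have h2 := card_union_add_card_inter T (T.image π)
  rw [card_image_of_injective _ (Function.LeftInverse.injective hinv)] at h2
  have h3 : T ∩ T.image π = T.filter (fun x => π x ∈ T) := by
    ext x
    simp only [mem_inter, mem_image, mem_filter]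
    constructor
    · rintro ⟨hxT, y, hy, rfl⟩
      rw [hinv]; exact ⟨hxT, hy⟩
    · rintro ⟨hxT, hπx⟩
      exact ⟨hxT, π x, hπx, hinv x⟩
  rw [h3] at h2
  omega

end Keys

end Summit.PneNP.PneNP.Theorems.ChebyshevTracialDesignInvolutionKeys
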